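import Mathlib
import Summits.ValiantsHypothesis.ValiantsHypothesis.Theorems.FifoMatchingNNDivisionHardFewFlatsExp
import Summits.ValiantsHypothesis.ValiantsHypothesis.Theorems.FifoMatchingNNDivisionHardLocalization
import HarnessLib

/-!
# The PARALLEL-FLATS class as a `c`-FREE DECIDED PASSENGER CLASS of line `virtual_passenger` (crux `Theses.FifoMatching.NNDivisionHard`,
# stmt-ValiantsHypothesis-21181) — the by-name hook `fewFlats_decided : Localization.Decided (…)`

The line's partition (`Lines/virtual_passenger.lean`, research stub `stub_coreLaw : CoreLawHull`) asks hardness only of passengers outside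
the cone `ConeD` of DECIDED classes, each entered BY NAME as a predicate `X : Localization.PClass` with a theorem `Localization.Decided X`
(crit-9's design rule «new disjuncts of `ConeD`, each with its `_decided` theorem»; glue `Localization.decided_or`, localization
`Localization.decided_loc`, switching `decided_orbStar`).  Class D of the cone is `DimDeficient` (`dim aff q + lvl h ≤ h`).  This file
states the PARALLEL-FLATS class of ✓ `…FewFlatsRung` / ✓ `…FewFlatsExp` in exactly that shape — it is `c`-FREE (its thresholds depend on
`h` only) — and proves it decided:

* ★ `fewFlats_decided : Localization.Decided (fun h K q => ∃ N π V, (equal labels ⇒ difference in V) ∧ 2·dim V ≤ h ∧ N·2^{⌈(h/2)/2⌉} ≤ 3^{⌈(h/2)/2⌉})`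
  — labels `π : Fin (K+1) → Fin N` (read: `N ≤ 1.22^{h/2}` parallel translates of a direction space of dimension `≤ h/2`).
  It contains every `DimDeficient`-type family with `2·dim ≤ h` (`N = 1`) and every family with at most `1.22^{h/2}` distinct points
  (`V = ⊥`), and e.g. sums `conv q₁ + conv q₂` of the two; through `Localization.decided_loc` / `decided_orbStar` its `√h`-deletion
  minors and switching images come for free once the pen adds the disjunct.

No definitions (the class is written as a lambda, as `Localization.Decided` expects), no named facts, no sorry.

HONEST FRAMING: one more decided sub-population for the line's partition; the research stub `stub_coreLaw` / COR-VIRTUAL / stmt-21181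
`NNDivisionHard` stay OPEN; `VP ≠ VNP` NOT proved; nothing here is a summit statement.  [cite: KaibelWeltge2014, Thm. 1]
-/

set_option autoImplicit false

-- the mandated summit-side namespace repeats a component by design (single-problem summit)
set_option linter.dupNamespace false

noncomputable section

namespace Summit.ValiantsHypothesis.ValiantsHypothesis.Theorems.FifoMatching

namespace FewFlats

open Literature.Barriers.PneNP (HasEFOfSize)
open Literature.Combinatorics.Optimization (corPolytopeGraph)
open Summit.ValiantsHypothesis.ValiantsHypothesis.Theorems.FifoMatching.Localization (PClass Decided Fam)

/-- ★ **THE PARALLEL-FLATS CLASS IS DECIDED** (in the line's `Localization.Decided` shape, `c`-free): for every `c`, eventually in `h`,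
every family `q : Fin (K+1) → ℝ^{h×h}` labelled by `π : Fin (K+1) → Fin N` with equal-label differences in `V`, `2·dim V ≤ h` and
`N · 2^{h/2 − ⌊(h/2)/2⌋} ≤ 3^{h/2 − ⌊(h/2)/2⌋}`, together with a size-`r` extended formulation of `COR(K_h) + conv q`, forces `T c h < r`.
[cite: KaibelWeltge2014, Thm. 1] -/
theorem fewFlats_decided :
    Decided (fun h K q => ∃ (N : ℕ) (π : Fin (K + 1) → Fin N) (V : Submodule ℝ (Fin h × Fin h → ℝ)),
      (∀ j j', π j = π j' → q j - q j' ∈ V) ∧ 2 * Module.finrank ℝ ↥V ≤ h ∧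
        N * 2 ^ (h / 2 - (h / 2) / 2) ≤ 3 ^ (h / 2 - (h / 2) / 2)) := by
  intro c
  obtain ⟨h₀, hh₀⟩ := corMinkowskiHard_fewFlats c
  refine ⟨h₀, fun h hh K q r hX hEF => ?_⟩
  obtain ⟨N, π, V, hV, hdim, hN⟩ := hX
  have hN' : Fintype.card (Fin N) * 2 ^ (h / 2 - (h / 2) / 2) ≤ 3 ^ (h / 2 - (h / 2) / 2) := by
    rw [Fintype.card_fin]; exact hN
  exact hh₀ h hh q π V r hV hdim hN' hEF

/-- the dimension-deficient families with `2·dim aff q ≤ h` are in the class (`N = 1`, `V = vectorSpan (range q)`). -/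
theorem fewFlats_of_two_mul_finrank_le {h K : ℕ} (q : Fam h K)
    (hd : 2 * Module.finrank ℝ ↥(vectorSpan ℝ (Set.range q)) ≤ h) (h3 : 2 ^ (h / 2 - (h / 2) / 2) ≤ 3 ^ (h / 2 - (h / 2) / 2)) :
    ∃ (N : ℕ) (π : Fin (K + 1) → Fin N) (V : Submodule ℝ (Fin h × Fin h → ℝ)),
      (∀ j j', π j = π j' → q j - q j' ∈ V) ∧ 2 * Module.finrank ℝ ↥V ≤ h ∧
        N * 2 ^ (h / 2 - (h / 2) / 2) ≤ 3 ^ (h / 2 - (h / 2) / 2) := by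
  refine ⟨1, fun _ => 0, vectorSpan ℝ (Set.range q), fun j j' _ => ?_, hd, by simpa using h3⟩
  have := vsub_mem_vectorSpan ℝ (Set.mem_range_self (f := q) j) (Set.mem_range_self (f := q) j')
  rwa [vsub_eq_sub] at this

/-- the families with few DISTINCT points are in the class (`V = ⊥`, labels = the points): if `q` factors through `Fin N` with
`N · 2^{h/2 − ⌊(h/2)/2⌋} ≤ 3^{h/2 − ⌊(h/2)/2⌋}`. -/
theorem fewFlats_of_factor {h K N : ℕ} (q : Fam h K) (π : Fin (K + 1) → Fin N) (v : Fin N → (Fin h × Fin h → ℝ))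
    (hq : ∀ j, q j = v (π j)) (hN : N * 2 ^ (h / 2 - (h / 2) / 2) ≤ 3 ^ (h / 2 - (h / 2) / 2)) :
    ∃ (N : ℕ) (π : Fin (K + 1) → Fin N) (V : Submodule ℝ (Fin h × Fin h → ℝ)),
      (∀ j j', π j = π j' → q j - q j' ∈ V) ∧ 2 * Module.finrank ℝ ↥V ≤ h ∧
        N * 2 ^ (h / 2 - (h / 2) / 2) ≤ 3 ^ (h / 2 - (h / 2) / 2) := by
  refine ⟨N, π, ⊥, fun j j' hπ => ?_, by simp, hN⟩
  rw [hq j, hq j', hπ, sub_self]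
  exact Submodule.zero_mem _

end FewFlats

end Summit.ValiantsHypothesis.ValiantsHypothesis.Theorems.FifoMatching

end
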